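import Mathlib
import Summits.QuantumAdvantage.QuantumAdvantage.Theorems.MobiusLadderQuadraticDigitPhasesLowCutKataiCases

/-!
# Dickson / symplectic normal form modulo the band (stub `stub_dickson`)

The stub `stub_dickson` of the crux `MobiusLadder.QuadraticDigitPhases`
(stmt-QuantumAdvantage-1391), line `Sketch`, with its lemmas.

`P` is a quadratic form in the binary digits `x_0, …, x_{n-1}` over `𝔽₂`, `c_{ij} = coeff (X_i X_j) P`.
The *far matrix* `A` of `P` at band width `s` has entries `A i j = c_{ij}` if `dist i j > s` and `0`
otherwise; it is symmetric with zero diagonal, i.e. ALTERNATING over `𝔽₂`.  `P` is `(R,s)`-low if it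
agrees everywhere with an `s`-banded quadratic `Q` plus fewer than `R` products of two linear forms.
* `rank_peel_add_two_le`: one step of symplectic elimination.  For an alternating `B` with
  `B i j = 1`, the matrix `B' = B + (B i)(B j)ᵀ + (B j)(B i)ᵀ` has `rank B' + 2 ≤ rank B`: the kernel
  of `B'` contains `ker B` and the two unit vectors `e_i`, `e_j`, which are independent modulo `ker B`
  (rank–nullity).
* `exists_symplectic_of_rank_le`: iterating, an alternating `B` is a sum of `h` symmetrised rank-one
  pairs `u_t v_tᵀ + v_t u_tᵀ` with `2h ≤ rank B` (Dickson's theorem, [folklore]).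
* `low_of_symplectic`: if the far pair coefficients of `P` are those of `Σ_{t<h} sym(u_t, v_t)`, then
  `Q := P − Σ_t (u_t·X)(v_t·X)` is `s`-banded of degree `≤ 2`, so `P` is `Q` plus `h` products.
* `stub_dickson`: hence, contrapositively, if `P` is not `(R,s)`-low then `2R ≤ rank A`.

Mathlib + the landed sibling `…LowCutKataiCases` (`monomial_eq_of_two_mem`).
-/

set_option linter.dupNamespace false -- D-0017: single-problem summit ⇒ `QuantumAdvantage.QuantumAdvantage` by design

namespace Summit.QuantumAdvantage.QuantumAdvantage.Theorems.MobiusLadderQuadraticDigitPhasesStubDickson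

open Finset MvPolynomial
open scoped Matrix
open Summit.QuantumAdvantage.QuantumAdvantage.Theorems.MobiusLadderQuadraticDigitPhasesLowCutKataiCases
  (monomial_eq_of_two_mem)

section Symplectic

variable {n : ℕ}

/-- A nonzero element of `ZMod 2` is `1`. -/
theorem eq_one_of_ne_zero (x : ZMod 2) (hx : x ≠ 0) : x = 1 := by
  revert x
  decide

/-- **Symplectic elimination step.**  Let `B` be alternating (symmetric, zero diagonal) over `𝔽₂`
with `B i j = 1`, and `B' a b = B a b + B i a * B j b + B j a * B i b` (i.e.
`B' = B + (B i)(B j)ᵀ + (B j)(B i)ᵀ`).  Then `rank B' + 2 ≤ rank B`: `ker B ≤ ker B'`, the unit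
vectors `e_i, e_j` lie in `ker B'`, `e_i ∉ ker B` (`(B e_i)_j = 1`) and `e_j ∉ ker B + 𝔽₂ e_i`
(`(B e_j)_i = 1`, `(B e_i)_i = 0`); conclude by rank–nullity. -/
theorem rank_peel_add_two_le (B B' : Matrix (Fin n) (Fin n) (ZMod 2)) (hs : ∀ a b, B a b = B b a)
    (hd : ∀ a, B a a = 0) {i j : Fin n} (hij : B i j = 1)
    (hB' : ∀ a b, B' a b = B a b + B i a * B j b + B j a * B i b) :
    B'.rank + 2 ≤ B.rank := by
  classical
  have hji : B j i = 1 := (hs j i).trans hij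
  -- `B' x = B x + (B x)_j • B i + (B x)_i • B j`
  have hmul : ∀ (x : Fin n → ZMod 2) (a : Fin n),
      (B' *ᵥ x) a = (B *ᵥ x) a + B i a * (B *ᵥ x) j + B j a * (B *ᵥ x) i := by
    intro x a
    simp only [Matrix.mulVec_apply_eq_sum, hB', add_mul, Finset.sum_add_distrib, mul_assoc,
      Finset.mul_sum]
  have hcolB : ∀ c a : Fin n, (B *ᵥ Pi.single c 1) a = B a c := by
    intro c a
    rw [Matrix.mulVec_single_one, Matrix.col_apply]
  have hcolB' : ∀ c a : Fin n, (B' *ᵥ Pi.single c 1) a = B' a c := by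
    intro c a
    rw [Matrix.mulVec_single_one, Matrix.col_apply]
  -- `ker B ≤ ker B'`
  have hK : LinearMap.ker B.mulVecLin ≤ LinearMap.ker B'.mulVecLin := by
    intro x hx
    rw [LinearMap.mem_ker, Matrix.mulVecLin_apply] at hx ⊢
    funext a
    rw [hmul, hx]
    simp
  -- `e_i, e_j ∈ ker B'`
  have hei : (Pi.single i 1 : Fin n → ZMod 2) ∈ LinearMap.ker B'.mulVecLin := by
    rw [LinearMap.mem_ker, Matrix.mulVecLin_apply]
    funext a
    rw [hcolB', hB', hs a i, hji, hd i, Pi.zero_apply, mul_one, mul_zero, add_zero]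
    exact CharTwo.add_self_eq_zero _
  have hej : (Pi.single j 1 : Fin n → ZMod 2) ∈ LinearMap.ker B'.mulVecLin := by
    rw [LinearMap.mem_ker, Matrix.mulVecLin_apply]
    funext a
    rw [hcolB', hB', hs a j, hd j, hij, Pi.zero_apply, mul_zero, mul_one, add_zero]
    exact CharTwo.add_self_eq_zero _
  -- `e_i ∉ ker B`
  have hniK : (Pi.single i 1 : Fin n → ZMod 2) ∉ LinearMap.ker B.mulVecLin := by
    intro h
    rw [LinearMap.mem_ker, Matrix.mulVecLin_apply] at h
    have h1 := congrFun h j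
    rw [hcolB, hji, Pi.zero_apply] at h1
    exact one_ne_zero h1
  -- `e_j ∉ ker B + 𝔽₂ e_i`
  have hnjK : (Pi.single j 1 : Fin n → ZMod 2) ∉
      LinearMap.ker B.mulVecLin ⊔ Submodule.span (ZMod 2) {(Pi.single i 1 : Fin n → ZMod 2)} := by
    intro h
    obtain ⟨y, hy, z, hz, hyz⟩ := Submodule.mem_sup.mp h
    obtain ⟨c, rfl⟩ := Submodule.mem_span_singleton.mp hz
    rw [LinearMap.mem_ker, Matrix.mulVecLin_apply] at hy
    have h1 := congrFun (congrArg B.mulVec hyz) i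
    rw [Matrix.mulVec_add, Matrix.mulVec_smul, hy, zero_add, Pi.smul_apply, hcolB, hcolB, hd i,
      hij, smul_zero] at h1
    exact zero_ne_one h1
  -- the chain `ker B < ker B + e_i < ker B + e_i + e_j ≤ ker B'`
  have hlt1 : LinearMap.ker B.mulVecLin <
      LinearMap.ker B.mulVecLin ⊔ Submodule.span (ZMod 2) {(Pi.single i 1 : Fin n → ZMod 2)} :=
    SetLike.lt_iff_le_and_exists.mpr ⟨le_sup_left, Pi.single i 1,
      Submodule.mem_sup_right (Submodule.mem_span_singleton_self _), hniK⟩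
  have hlt2 : LinearMap.ker B.mulVecLin ⊔ Submodule.span (ZMod 2) {(Pi.single i 1 : Fin n → ZMod 2)} <
      (LinearMap.ker B.mulVecLin ⊔ Submodule.span (ZMod 2) {(Pi.single i 1 : Fin n → ZMod 2)}) ⊔
        Submodule.span (ZMod 2) {(Pi.single j 1 : Fin n → ZMod 2)} :=
    SetLike.lt_iff_le_and_exists.mpr ⟨le_sup_left, Pi.single j 1,
      Submodule.mem_sup_right (Submodule.mem_span_singleton_self _), hnjK⟩
  have hle3 : (LinearMap.ker B.mulVecLin ⊔ Submodule.span (ZMod 2) {(Pi.single i 1 : Fin n → ZMod 2)}) ⊔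
        Submodule.span (ZMod 2) {(Pi.single j 1 : Fin n → ZMod 2)} ≤ LinearMap.ker B'.mulVecLin :=
    sup_le (sup_le hK ((Submodule.span_singleton_le_iff_mem _ _).mpr hei))
      ((Submodule.span_singleton_le_iff_mem _ _).mpr hej)
  have h1 := Submodule.finrank_lt_finrank_of_lt hlt1
  have h2 := Submodule.finrank_lt_finrank_of_lt hlt2
  have h3 := Submodule.finrank_mono hle3
  have hB := LinearMap.finrank_range_add_finrank_ker B.mulVecLin
  have hB'' := LinearMap.finrank_range_add_finrank_ker B'.mulVecLin
  unfold Matrix.rank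
  omega

/-- **Dickson's theorem** (symplectic normal form of an alternating matrix over `𝔽₂`, [folklore]).
An alternating `B` (symmetric, zero diagonal) of rank `≤ r` is a sum of `h` symmetrised rank-one
pairs, `B a b = Σ_{t<h} (u_t a v_t b + u_t b v_t a)`, with `2h ≤ rank B`.  Induction on `r`: if
`B ≠ 0` pick `B i j = 1` and peel (`rank_peel_add_two_le`). -/
theorem exists_symplectic_of_rank_le (r : ℕ) : ∀ B : Matrix (Fin n) (Fin n) (ZMod 2), B.rank ≤ r →
    (∀ a b, B a b = B b a) → (∀ a, B a a = 0) →
    ∃ (h : ℕ) (u v : Fin h → Fin n → ZMod 2), 2 * h ≤ B.rank ∧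
      ∀ a b, B a b = ∑ t, (u t a * v t b + u t b * v t a) := by
  induction r with
  | zero =>
    intro B hr hs hd
    by_cases hz : ∀ a b, B a b = 0
    · exact ⟨0, fun t => t.elim0, fun t => t.elim0, by omega, fun a b => by simp [hz]⟩
    · push Not at hz
      obtain ⟨i, j, hij⟩ := hz
      obtain ⟨B', hB'⟩ : ∃ B' : Matrix (Fin n) (Fin n) (ZMod 2),
          ∀ a b, B' a b = B a b + B i a * B j b + B j a * B i b :=
        ⟨Matrix.of fun a b => B a b + B i a * B j b + B j a * B i b, fun _ _ => rfl⟩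
      have := rank_peel_add_two_le B B' hs hd (eq_one_of_ne_zero _ hij) hB'
      omega
  | succ r ih =>
    intro B hr hs hd
    by_cases hz : ∀ a b, B a b = 0
    · exact ⟨0, fun t => t.elim0, fun t => t.elim0, by omega, fun a b => by simp [hz]⟩
    · push Not at hz
      obtain ⟨i, j, hij⟩ := hz
      obtain ⟨B', hB'⟩ : ∃ B' : Matrix (Fin n) (Fin n) (ZMod 2),
          ∀ a b, B' a b = B a b + B i a * B j b + B j a * B i b :=
        ⟨Matrix.of fun a b => B a b + B i a * B j b + B j a * B i b, fun _ _ => rfl⟩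
      have hrk := rank_peel_add_two_le B B' hs hd (eq_one_of_ne_zero _ hij) hB'
      have hs' : ∀ a b, B' a b = B' b a := fun a b => by
        rw [hB', hB', hs a b]
        ring
      have hd' : ∀ a, B' a a = 0 := fun a => by
        rw [hB', hd a, zero_add, mul_comm]
        exact CharTwo.add_self_eq_zero _
      obtain ⟨h, u, v, hh, hdec⟩ := ih B' (by omega) hs' hd'
      refine ⟨h + 1, Fin.cons (B i) u, Fin.cons (B j) v, by omega, fun a b => ?_⟩
      rw [Fin.sum_univ_succ]
      simp only [Fin.cons_zero, Fin.cons_succ]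
      rw [← hdec a b, hB']
      linear_combination (-(B i a * B j b + B i b * B j a)) * (CharTwo.two_eq_zero (R := ZMod 2))

end Symplectic

section Poly

variable {n : ℕ}

/-- A product of two linear forms as a double sum of pair monomials. -/
theorem linMul_eq (u v : Fin n → ZMod 2) :
    ((∑ i, C (u i) * X i) * (∑ i, C (v i) * X i) : MvPolynomial (Fin n) (ZMod 2)) =
      ∑ i : Fin n, ∑ j : Fin n, monomial (Finsupp.single i 1 + Finsupp.single j 1) (u i * v j) := by
  rw [Finset.sum_mul_sum]
  refine Finset.sum_congr rfl fun i _ => Finset.sum_congr rfl fun j _ => ?_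
  rw [C_mul_X_eq_monomial, C_mul_X_eq_monomial, monomial_mul]

/-- A double sum with a single live term. -/
theorem sum_sum_ite_eq (f : Fin n → Fin n → ZMod 2) (a b : Fin n) :
    ∑ i, ∑ j, (if i = a ∧ j = b then f i j else 0) = f a b := by
  rw [Finset.sum_eq_single_of_mem a (mem_univ _) fun i _ hi =>
    Finset.sum_eq_zero fun j _ => if_neg fun h => hi h.1]
  rw [Finset.sum_eq_single_of_mem b (mem_univ _) fun j _ hj => if_neg fun h => hj h.2]
  rw [if_pos ⟨rfl, rfl⟩]

/-- The coefficient of `X_a X_b`, `a ≠ b`, in `(Σ uᵢ Xᵢ)(Σ vᵢ Xᵢ)` is `u_a v_b + u_b v_a`. -/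
theorem coeff_pair_linMul (u v : Fin n → ZMod 2) {a b : Fin n} (hab : a ≠ b) :
    coeff (Finsupp.single a 1 + Finsupp.single b 1)
      ((∑ i, C (u i) * X i) * (∑ i, C (v i) * X i) : MvPolynomial (Fin n) (ZMod 2)) =
      u a * v b + u b * v a := by
  classical
  rw [linMul_eq]
  simp only [coeff_sum, coeff_monomial]
  have key : ∀ i j : Fin n, (if Finsupp.single i 1 + Finsupp.single j 1 =
      Finsupp.single a 1 + Finsupp.single b 1 then u i * v j else 0) =
      (if i = a ∧ j = b then u i * v j else 0) + (if i = b ∧ j = a then u i * v j else 0) := by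
    intro i j
    by_cases h1 : i = a ∧ j = b
    · obtain ⟨rfl, rfl⟩ := h1
      rw [if_pos rfl, if_pos ⟨rfl, rfl⟩, if_neg fun h => hab h.1, add_zero]
    · by_cases h2 : i = b ∧ j = a
      · obtain ⟨rfl, rfl⟩ := h2
        rw [if_pos (add_comm _ _), if_neg h1, if_pos ⟨rfl, rfl⟩, zero_add]
      · rw [if_neg, if_neg h1, if_neg h2, add_zero]
        rw [Finsupp.single_add_single_eq_single_add_single one_ne_zero one_ne_zero]
        rintro (h | ⟨-, h⟩ | ⟨h, -⟩)
        · exact h1 h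
        · exact h2 h
        · omega
  simp only [key, Finset.sum_add_distrib, sum_sum_ite_eq]

/-- A linear form has total degree `≤ 1`. -/
theorem totalDegree_linForm_le (u : Fin n → ZMod 2) :
    (∑ i, C (u i) * X i : MvPolynomial (Fin n) (ZMod 2)).totalDegree ≤ 1 :=
  totalDegree_finsetSum_le fun i _ =>
    (totalDegree_mul _ _).trans (by rw [totalDegree_C, totalDegree_X, zero_add])

/-- **From a symplectic decomposition of the far coefficients to lowness.**  If the far pair
coefficients of `P` (`a ≠ b`, `dist a b > s`) are `Σ_{t<h} (u_t a v_t b + u_t b v_t a)`, then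
`Q := P − Σ_t (Σ u_t i X_i)(Σ v_t i X_i)` has total degree `≤ 2`, is `s`-banded (a monomial of `Q`
with two distinct variables is `X_a X_b`, and its coefficient vanishes when `dist a b > s`), and
`P(x) = Q(x) + Σ_t (u_t·x)(v_t·x)`. -/
theorem low_of_symplectic {s h : ℕ} {P : MvPolynomial (Fin n) (ZMod 2)} (hP : P.totalDegree ≤ 2)
    (u v : Fin h → Fin n → ZMod 2)
    (hfar : ∀ a b : Fin n, a ≠ b → s < Nat.dist a b →
      coeff (Finsupp.single a 1 + Finsupp.single b 1) P = ∑ t, (u t a * v t b + u t b * v t a)) :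
    ∃ Q : MvPolynomial (Fin n) (ZMod 2), Q.totalDegree ≤ 2 ∧
      (∀ m ∈ Q.support, ∀ i ∈ m.support, ∀ j ∈ m.support, Nat.dist i j ≤ s) ∧
      ∀ x : Fin n → ZMod 2, eval x P = eval x Q +
        ∑ t : Fin h, (∑ i : Fin n, u t i * x i) * (∑ i : Fin n, v t i * x i) := by
  classical
  obtain ⟨q, hq⟩ : ∃ q : MvPolynomial (Fin n) (ZMod 2),
      q = ∑ t : Fin h, (∑ i, C (u t i) * X i) * (∑ i, C (v t i) * X i) := ⟨_, rfl⟩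
  have hqdeg : q.totalDegree ≤ 2 := hq ▸ totalDegree_finsetSum_le fun t _ =>
    (totalDegree_mul _ _).trans (add_le_add (totalDegree_linForm_le _) (totalDegree_linForm_le _))
  have hQdeg : (P - q).totalDegree ≤ 2 := (totalDegree_sub P q).trans (max_le hP hqdeg)
  have hcoeffq : ∀ a b : Fin n, a ≠ b →
      coeff (Finsupp.single a 1 + Finsupp.single b 1) q = ∑ t, (u t a * v t b + u t b * v t a) := by
    intro a b hab
    rw [hq, coeff_sum]
    exact Finset.sum_congr rfl fun t _ => coeff_pair_linMul (u t) (v t) hab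
  have hband : ∀ m ∈ (P - q).support, ∀ i ∈ m.support, ∀ j ∈ m.support, Nat.dist i j ≤ s := by
    intro m hm i hi j hj
    by_contra hfar'
    have hij : i ≠ j := by
      rintro rfl
      simp at hfar'
    have hc : coeff m (P - q) ≠ 0 := mem_support_iff.mp hm
    rw [monomial_eq_of_two_mem hQdeg hm hij hi hj, coeff_sub, hcoeffq i j hij,
      hfar i j hij (not_le.mp hfar'), sub_self] at hc
    exact hc rfl
  have hevalq : ∀ x : Fin n → ZMod 2,
      eval x q = ∑ t : Fin h, (∑ i, u t i * x i) * (∑ i, v t i * x i) := by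
    intro x
    simp only [hq, map_sum, map_mul, eval_C, eval_X]
  exact ⟨P - q, hQdeg, hband, fun x => by rw [map_sub, hevalq, sub_add_cancel]⟩

end Poly

/-- **Dickson / symplectic normal form modulo the band** (stub `stub_dickson`), stated
contrapositively.  The far matrix `A` (entries `coeff (X_i X_j) P` at `dist i j > s`, else `0`) is
alternating over `𝔽₂`; by `exists_symplectic_of_rank_le` it is `Σ_{t<h} sym(u_t, v_t)` with
`2h ≤ rank A`, and `low_of_symplectic` makes `P` an `s`-banded quadratic plus `h` products of linear
forms.  So if `P` is not `(R,s)`-low then `R ≤ h`, i.e. `2R ≤ rank A`. -/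
theorem stub_dickson :
    ∀ (n : ℕ) (P : MvPolynomial (Fin n) (ZMod 2)) (R s : ℕ), P.totalDegree ≤ 2 →
      ¬ (∃ Q : MvPolynomial (Fin n) (ZMod 2), Q.totalDegree ≤ 2 ∧ (∀ m ∈ Q.support, ∀ i ∈ m.support, ∀ j ∈ m.support, Nat.dist i j ≤ s) ∧ ∃ k : ℕ, k < R ∧ ∃ u v : Fin k → Fin n → ZMod 2, ∀ x : Fin n → ZMod 2, MvPolynomial.eval x P = MvPolynomial.eval x Q + ∑ t : Fin k, (∑ i : Fin n, u t i * x i) * (∑ i : Fin n, v t i * x i)) →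
      2 * R ≤ (Matrix.of fun (i j : Fin n) => if (i : ℕ) ∈ Finset.range n ∧ (j : ℕ) < n ∧ s < Nat.dist (i : ℕ) (j : ℕ) then MvPolynomial.coeff (Finsupp.single i 1 + Finsupp.single j 1) P else 0).rank := by
  intro n P R s hP hnl
  by_contra hlt
  rw [not_le] at hlt
  set A : Matrix (Fin n) (Fin n) (ZMod 2) := Matrix.of fun (i j : Fin n) =>
    if (i : ℕ) ∈ Finset.range n ∧ (j : ℕ) < n ∧ s < Nat.dist (i : ℕ) (j : ℕ) then
      MvPolynomial.coeff (Finsupp.single i 1 + Finsupp.single j 1) P else 0 with hA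
  have hAapply : ∀ a b : Fin n, A a b = if s < Nat.dist (a : ℕ) (b : ℕ) then
      coeff (Finsupp.single a 1 + Finsupp.single b 1) P else 0 := by
    intro a b
    rw [hA, Matrix.of_apply]
    have ha : (a : ℕ) ∈ Finset.range n := Finset.mem_range.mpr a.isLt
    by_cases h : s < Nat.dist (a : ℕ) (b : ℕ)
    · rw [if_pos ⟨ha, b.isLt, h⟩, if_pos h]
    · rw [if_neg fun h' => h h'.2.2, if_neg h]
  have hAs : ∀ a b, A a b = A b a := by
    intro a b
    rw [hAapply, hAapply, Nat.dist_comm, add_comm (Finsupp.single a 1)]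
  have hAd : ∀ a, A a a = 0 := by
    intro a
    rw [hAapply, Nat.dist_self, if_neg (Nat.not_lt_zero s)]
  obtain ⟨h, u, v, hh, hdec⟩ := exists_symplectic_of_rank_le A.rank A le_rfl hAs hAd
  obtain ⟨Q, hQ, hband, heval⟩ := low_of_symplectic hP u v fun a b _ hfar => by
    rw [← hdec, hAapply, if_pos hfar]
  exact hnl ⟨Q, hQ, hband, h, by omega, u, v, heval⟩

end Summit.QuantumAdvantage.QuantumAdvantage.Theorems.MobiusLadderQuadraticDigitPhasesStubDickson
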